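import Mathlib.Analysis.SpecialFunctions.Trigonometric.Deriv
import Summits.NavierStokesRegularity.NavierStokesRegularity.Theorems.SoloRefuteKyritsis2022
import HarnessLib

/-!
# NS-claims map, C03 (Kyritsis 2022), part 4: a viscous two-mode shear flow

Continuation of `SoloRefuteKyritsis2022.lean` (toolkit `bv`/`pr`, static countermodel,
`not_Step_6`), `…Shear.lean`, `…Flow.lean` (`not_Step_10`, `not_Theorem44Infinite`, `not_Step_11`).
This part builds the countermodel used against `Step_9` (Thm 4.3, ball form (4.7)/(4.8),
pp. 2552–2553, Navier–Stokes branch of `theorem44Finite_of_steps`) in part 5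
`SoloRefuteKyritsis2022ViscFlux.lean`: the heat-equation shear flow
`u(t,y) = φ(t,y₀) e₂`, `φ(t,s) = −e^{−t} sin s + e^{−4t} sin 2s` — a global classical
Navier–Stokes solution (`ν = 1`, no force, zero pressure) — with its explicit volume-preserving
trajectory maps `X(t,a) = a + (∫₀ᵗ φ(τ,a₀)dτ) e₂`, `Y(t,·) = X(t,·)⁻¹`, packaged as the typed
`IsFlowOn`.  Print locator: K. E. Kyritsis, J. Appl. Math. Phys. 10 (2022) 2538–2560, Thm 4.3.
Axioms: `propext`, `Classical.choice`, `Quot.sound` only.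
WHAT THIS IS NOT: not a claim about NS regularity or blow-up; not a claim about any author beyond
the typed locator.
-/

noncomputable section

open Real Set Function MeasureTheory InnerProductSpace
open Literature.Analysis.FluidPDE
open scoped ContDiff RealInnerProductSpace Laplacian

-- The summit's canonical theorem namespace repeats the summit name (single-conjunct summit).
set_option linter.dupNamespace false

namespace Summit.NavierStokesRegularity.NavierStokesRegularity.Theorems.Kyritsis2022

/-- Coordinate projections are their own derivative. [folklore] -/
private theorem hasFDerivAt_coord (j : Fin 3) (x : EuclideanSpace ℝ (Fin 3)) :
    HasFDerivAt (fun y : EuclideanSpace ℝ (Fin 3) => y j) (pr j) x :=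
  (pr j).hasFDerivAt

/-! ## The viscous two-mode shear flow

The heat-equation shear flow `u(t,y) = φ(t,y₀) e₂`, `φ(t,s) = −e^{−t} sin s + e^{−4t} sin 2s`
(`ν = 1`, no force, zero pressure) with its explicit volume-preserving trajectory maps
`X(t,a) = a + (∫₀ᵗ φ(τ,a₀)dτ) e₂`.  Its vorticity is `ω(t,y) = (0, −∂ₛφ(t,y₀), 0)` and is carried
unchanged by `DY(t)`, so the material flux average of Def. 4.1 through the image of the ball
`B(0,1/4)` along `e₁` equals `⨍_{B(0,1/4)} (e^{−t} cos y₀ − 2e^{−4t} cos 2y₀) dy`: negative at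
`t = 0` (the fast mode dominates) and positive at `t = 1` (the fast mode has decayed). -/

/-- Profile `φ(t,s) = −e^{−t} sin s + e^{−4t} sin 2s`. -/
def prof (t s : ℝ) : ℝ := -(exp (-t) * sin s) + exp (-(4 * t)) * sin (2 * s)

/-- `∂ₛφ`. -/
def profD (t s : ℝ) : ℝ := -(exp (-t) * cos s) + 2 * exp (-(4 * t)) * cos (2 * s)

/-- `∂ₛ∂ₛφ = ∂ₜφ`. -/
def profDD (t s : ℝ) : ℝ := exp (-t) * sin s - 4 * exp (-(4 * t)) * sin (2 * s)

/-- `∫₀ᵗ φ(τ,s) dτ`. -/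
def profI (t s : ℝ) : ℝ := (exp (-t) - 1) * sin s + (1 - exp (-(4 * t))) / 4 * sin (2 * s)

/-- `∂ₛ ∫₀ᵗ φ(τ,s) dτ`. -/
def profID (t s : ℝ) : ℝ := (exp (-t) - 1) * cos s + (1 - exp (-(4 * t))) / 2 * cos (2 * s)

/-- `s ↦ φ(t,s)` has derivative `∂ₛφ`. -/
theorem hasDerivAt_prof_s (t s : ℝ) : HasDerivAt (fun s => prof t s) (profD t s) s := by
  have h := (((hasDerivAt_sin s).const_mul (exp (-t))).neg).add
    ((((hasDerivAt_id' s).const_mul 2).sin).const_mul (exp (-(4 * t))))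
  exact h.congr_deriv (by simp only [profD, mul_one]; ring)

/-- `s ↦ ∂ₛφ(t,s)` has derivative `∂ₛ∂ₛφ`. -/
theorem hasDerivAt_profD_s (t s : ℝ) : HasDerivAt (fun s => profD t s) (profDD t s) s := by
  have h := (((hasDerivAt_cos s).const_mul (exp (-t))).neg).add
    ((((hasDerivAt_id' s).const_mul 2).cos).const_mul (2 * exp (-(4 * t))))
  exact h.congr_deriv (by simp only [profDD, mul_one]; ring)

/-- `t ↦ φ(t,s)` has derivative `∂ₛ∂ₛφ` (the heat equation, mode by mode). -/
theorem hasDerivAt_prof_t (t s : ℝ) : HasDerivAt (fun t => prof t s) (profDD t s) t := by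
  have e1 : HasDerivAt (fun t : ℝ => exp (-t)) (exp (-t) * -1) t := (hasDerivAt_id' t).neg.exp
  have e4 : HasDerivAt (fun t : ℝ => exp (-(4 * t))) (exp (-(4 * t)) * -(4 * 1)) t :=
    ((hasDerivAt_id' t).const_mul 4).neg.exp
  have h := ((e1.mul_const (sin s)).neg).add (e4.mul_const (sin (2 * s)))
  exact h.congr_deriv (by simp only [profDD]; ring)

/-- `t ↦ ∫₀ᵗ φ(τ,s) dτ` has derivative `φ(t,s)`. -/
theorem hasDerivAt_profI_t (t s : ℝ) : HasDerivAt (fun t => profI t s) (prof t s) t := by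
  have e1 : HasDerivAt (fun t : ℝ => exp (-t)) (exp (-t) * -1) t := (hasDerivAt_id' t).neg.exp
  have e4 : HasDerivAt (fun t : ℝ => exp (-(4 * t))) (exp (-(4 * t)) * -(4 * 1)) t :=
    ((hasDerivAt_id' t).const_mul 4).neg.exp
  have h := ((e1.sub_const 1).mul_const (sin s)).add
    (((e4.const_sub 1).div_const 4).mul_const (sin (2 * s)))
  exact h.congr_deriv (by simp only [prof]; ring)

/-- `s ↦ ∫₀ᵗ φ(τ,s) dτ` has derivative `profID`. -/
theorem hasDerivAt_profI_s (t s : ℝ) : HasDerivAt (fun s => profI t s) (profID t s) s := by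
  have h := ((hasDerivAt_sin s).const_mul (exp (-t) - 1)).add
    ((((hasDerivAt_id' s).const_mul 2).sin).const_mul ((1 - exp (-(4 * t))) / 4))
  exact h.congr_deriv (by simp only [profID, mul_one]; ring)

/-- `∫₀⁰ = 0`. -/
@[simp] theorem profI_zero (s : ℝ) : profI 0 s = 0 := by
  simp [profI]

/-- At `t = 0`: `−∂ₛφ(0,s) = cos s − 2 cos 2s`. -/
theorem profD_zero (s : ℝ) : profD 0 s = -cos s + 2 * cos (2 * s) := by
  simp [profD]

/-- The viscous shear flow `u(t,y) = φ(t,y₀) e₂`. -/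
def visc (t : ℝ) (y : EuclideanSpace ℝ (Fin 3)) : EuclideanSpace ℝ (Fin 3) := prof t (y 0) • bv 2

/-- The constant operator `v ↦ v₀ e₂`. -/
def Lv : EuclideanSpace ℝ (Fin 3) →L[ℝ] EuclideanSpace ℝ (Fin 3) := (pr 0).smulRight (bv 2)

/-- Action of `Lv`. -/
@[simp] theorem Lv_apply (v : EuclideanSpace ℝ (Fin 3)) : Lv v = v 0 • bv 2 := rfl

/-- The space derivative of the viscous shear flow: `Du(t,y) = ∂ₛφ(t,y₀) Lv`. -/
theorem hasFDerivAt_visc (t : ℝ) (y : EuclideanSpace ℝ (Fin 3)) :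
    HasFDerivAt (visc t) (profD t (y 0) • Lv) y := by
  have h := ((hasDerivAt_prof_s t (y 0)).comp_hasFDerivAt y (hasFDerivAt_coord 0 y)).smul_const
    (bv 2)
  refine h.congr_fderiv ?_
  ext v i
  simp [smul_smul]

/-- `Du(t,·)` as a function. -/
theorem fderiv_visc (t : ℝ) :
    fderiv ℝ (visc t) = fun y : EuclideanSpace ℝ (Fin 3) => profD t (y 0) • Lv :=
  funext fun y => (hasFDerivAt_visc t y).fderiv

/-- The second space derivative of the viscous shear flow. -/
theorem hasFDerivAt_fderiv_visc (t : ℝ) (y : EuclideanSpace ℝ (Fin 3)) :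
    HasFDerivAt (fderiv ℝ (visc t)) ((profDD t (y 0) • pr 0).smulRight Lv) y := by
  rw [fderiv_visc]
  exact ((hasDerivAt_profD_s t (y 0)).comp_hasFDerivAt y (hasFDerivAt_coord 0 y)).smul_const Lv

/-- Jacobian table of the viscous shear flow: row `j` = `∂/∂yⱼ`, column `i` = component. -/
def jacV (t : ℝ) (y : EuclideanSpace ℝ (Fin 3)) : Fin 3 → Fin 3 → ℝ :=
  ![![0, 0, profD t (y 0)], ![0, 0, 0], ![0, 0, 0]]

/-- Entries of the space derivative of the viscous shear flow. -/
theorem fderiv_visc_single (t : ℝ) (y : EuclideanSpace ℝ (Fin 3)) (j i : Fin 3) :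
    fderiv ℝ (visc t) y (EuclideanSpace.single j 1) i = jacV t y j i := by
  rw [fderiv_visc]
  fin_cases j <;> fin_cases i <;> simp [jacV]

/-- The viscous shear flow is divergence free. -/
theorem isDivFree_visc (t : ℝ) : VectorCalculus.IsDivFree (visc t) := fun y => by
  rw [VectorCalculus.divergence, trace_eq_sum_coord, Fin.sum_univ_three]
  rw [fderiv_visc_single, fderiv_visc_single, fderiv_visc_single]
  simp [jacV]

/-- The vorticity of the viscous shear flow: `ω(t,y) = (0, −∂ₛφ(t,y₀), 0)`. -/
theorem curl_visc (t : ℝ) (y : EuclideanSpace ℝ (Fin 3)) :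
    curl (visc t) y = (-profD t (y 0)) • bv 1 := by
  rw [curl_eq_curlCLM, curlCLM_apply]
  simp only [fderiv_visc_single]
  ext i
  fin_cases i <;> simp [jacV]

/-- `(u·∇)u = 0` for the viscous shear flow. -/
theorem convect_visc (t : ℝ) (y : EuclideanSpace ℝ (Fin 3)) :
    convect (visc t) (visc t) y = 0 := by
  ext i
  rw [convect, clm_apply_coord, Fin.sum_univ_three, fderiv_visc_single, fderiv_visc_single,
    fderiv_visc_single]
  fin_cases i <;> simp [jacV, visc]

/-- `Δu(t,y) = ∂ₛ∂ₛφ(t,y₀) e₂`. -/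
theorem laplacian_visc (t : ℝ) (y : EuclideanSpace ℝ (Fin 3)) :
    (Δ (visc t)) y = profDD t (y 0) • bv 2 := by
  rw [laplacian_eq_iteratedFDeriv_orthonormalBasis (visc t) (EuclideanSpace.basisFun (Fin 3) ℝ)]
  simp_rw [iteratedFDeriv_two_apply, (hasFDerivAt_fderiv_visc t y).fderiv]
  rw [Fin.sum_univ_three]
  ext i
  fin_cases i <;> simp

/-- `∂ₜu(t,y) = ∂ₛ∂ₛφ(t,y₀) e₂` (two-sided, time set `univ`). -/
theorem timeDerivWithin_visc (t : ℝ) (y : EuclideanSpace ℝ (Fin 3)) :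
    timeDerivWithin univ visc t y = profDD t (y 0) • bv 2 := by
  rw [timeDerivWithin_apply, derivWithin_univ]
  exact ((hasDerivAt_prof_t t (y 0)).smul_const (bv 2)).deriv

/-- Joint smoothness of the viscous shear flow in `(t, y)`. -/
theorem contDiff_uncurry_visc : ContDiff ℝ ∞ (uncurry visc) := by
  have hc : ContDiff ℝ ∞ (fun q : ℝ × EuclideanSpace ℝ (Fin 3) => q.2 0) :=
    (pr 0).contDiff.comp contDiff_snd
  have e : uncurry visc = fun q : ℝ × EuclideanSpace ℝ (Fin 3) =>
      (-(exp (-q.1) * sin (q.2 0)) + exp (-(4 * q.1)) * sin (2 * q.2 0)) • bv 2 := rfl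
  rw [e]
  exact ((contDiff_fst.neg.exp.mul hc.sin).neg.add
    ((contDiff_const.mul contDiff_fst).neg.exp.mul (contDiff_const.mul hc).sin)).smul
    contDiff_const

/-- **The viscous shear flow is a global classical Navier–Stokes solution** (`ν = 1`, no force,
zero pressure) on `ℝ³ × ℝ`. -/
theorem isClassicalNSSolutionOn_visc_univ :
    IsClassicalNSSolutionOn univ 1 0 visc (fun _ _ => 0) where
  smooth_velocity := contDiff_uncurry_visc.contDiffOn
  smooth_pressure := contDiffOn_const
  momentum t _ y := by
    rw [timeDerivWithin_visc, convect_visc, laplacian_visc]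
    simp [gradient_fun_const]
  divFree t _ := isDivFree_visc t

/-- The viscous shear flow solves Navier–Stokes (`ν = 1`) on every time set with unique
derivatives. -/
theorem isClassicalNSSolutionOn_visc {S : Set ℝ} (hS : UniqueDiffOn ℝ S) :
    IsClassicalNSSolutionOn S 1 0 visc (fun _ _ => 0) :=
  isClassicalNSSolutionOn_visc_univ.mono (subset_univ S) hS

/-! ### The particle-trajectory map of the viscous shear flow -/

/-- The flow map `X(t,a) = (a₀, a₁, a₂ + ∫₀ᵗ φ(τ,a₀)dτ)`. -/
def viscX (t : ℝ) (a : EuclideanSpace ℝ (Fin 3)) : EuclideanSpace ℝ (Fin 3) :=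
  !₂[a 0, a 1, a 2 + profI t (a 0)]

/-- Its inverse `Y(t,x) = (x₀, x₁, x₂ − ∫₀ᵗ φ(τ,x₀)dτ)`. -/
def viscY (t : ℝ) (x : EuclideanSpace ℝ (Fin 3)) : EuclideanSpace ℝ (Fin 3) :=
  !₂[x 0, x 1, x 2 - profI t (x 0)]

/-- `X` in the standard basis. -/
theorem viscX_eq (t : ℝ) (a : EuclideanSpace ℝ (Fin 3)) :
    viscX t a = a 0 • bv 0 + a 1 • bv 1 + (a 2 + profI t (a 0)) • bv 2 := by
  ext i
  fin_cases i <;> simp [viscX]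

/-- `Y` in the standard basis. -/
theorem viscY_eq (t : ℝ) (x : EuclideanSpace ℝ (Fin 3)) :
    viscY t x = x 0 • bv 0 + x 1 • bv 1 + (x 2 - profI t (x 0)) • bv 2 := by
  ext i
  fin_cases i <;> simp [viscY]

/-- Component `0` of `X(t,a)` is `a₀`. -/
@[simp] theorem viscX_apply_zero (t : ℝ) (a : EuclideanSpace ℝ (Fin 3)) : viscX t a 0 = a 0 := by
  simp [viscX]

/-- `X(0,·) = id`. -/
theorem viscX_zero : viscX 0 = id := by
  funext a
  ext i
  fin_cases i <;> simp [viscX]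

/-- `Y ∘ X = id` at every time. -/
theorem viscY_viscX (t : ℝ) (a : EuclideanSpace ℝ (Fin 3)) : viscY t (viscX t a) = a := by
  ext i
  fin_cases i <;> simp [viscX, viscY]

/-- `X ∘ Y = id` at every time. -/
theorem viscX_viscY (t : ℝ) (x : EuclideanSpace ℝ (Fin 3)) : viscX t (viscY t x) = x := by
  ext i
  fin_cases i <;> simp [viscX, viscY]

/-- The space derivative of `X(t,·)`. -/
theorem hasFDerivAt_viscX (t : ℝ) (a : EuclideanSpace ℝ (Fin 3)) :
    HasFDerivAt (viscX t)
      ((pr 0).smulRight (bv 0) + (pr 1).smulRight (bv 1)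
        + (pr 2 + profID t (a 0) • pr 0).smulRight (bv 2)) a := by
  rw [show viscX t = fun a : EuclideanSpace ℝ (Fin 3) =>
      a 0 • bv 0 + a 1 • bv 1 + (a 2 + profI t (a 0)) • bv 2 from funext (viscX_eq t)]
  have h0 := (hasFDerivAt_coord 0 a).smul_const (bv 0)
  have h1 := (hasFDerivAt_coord 1 a).smul_const (bv 1)
  have h2 := ((hasFDerivAt_coord 2 a).add
    ((hasDerivAt_profI_s t (a 0)).comp_hasFDerivAt a (hasFDerivAt_coord 0 a))).smul_const (bv 2)
  exact (h0.add h1).add h2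

/-- The space derivative of `Y(t,·)`. -/
theorem hasFDerivAt_viscY (t : ℝ) (x : EuclideanSpace ℝ (Fin 3)) :
    HasFDerivAt (viscY t)
      ((pr 0).smulRight (bv 0) + (pr 1).smulRight (bv 1)
        + (pr 2 - profID t (x 0) • pr 0).smulRight (bv 2)) x := by
  rw [show viscY t = fun x : EuclideanSpace ℝ (Fin 3) =>
      x 0 • bv 0 + x 1 • bv 1 + (x 2 - profI t (x 0)) • bv 2 from funext (viscY_eq t)]
  have h0 := (hasFDerivAt_coord 0 x).smul_const (bv 0)
  have h1 := (hasFDerivAt_coord 1 x).smul_const (bv 1)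
  have h2 := ((hasFDerivAt_coord 2 x).sub
    ((hasDerivAt_profI_s t (x 0)).comp_hasFDerivAt x (hasFDerivAt_coord 0 x))).smul_const (bv 2)
  exact (h0.add h1).add h2

/-- `s ↦ ∫₀ᵗ φ(τ,s) dτ` is smooth. -/
theorem contDiff_profI (t : ℝ) : ContDiff ℝ ∞ (fun s => profI t s) := by
  unfold profI
  exact (contDiff_const.mul contDiff_sin).add
    (contDiff_const.mul (contDiff_const.mul contDiff_id).sin)

/-- `X(t,·)` is smooth. -/
theorem contDiff_viscX (t : ℝ) : ContDiff ℝ ∞ (viscX t) := by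
  rw [show viscX t = fun a : EuclideanSpace ℝ (Fin 3) =>
      a 0 • bv 0 + a 1 • bv 1 + (a 2 + profI t (a 0)) • bv 2 from funext (viscX_eq t)]
  have hc : ∀ j : Fin 3, ContDiff ℝ ∞ (fun a : EuclideanSpace ℝ (Fin 3) => a j) := fun j =>
    (pr j).contDiff
  exact ((((hc 0).smul contDiff_const).add ((hc 1).smul contDiff_const))).add
    (((hc 2).add ((contDiff_profI t).comp (hc 0))).smul contDiff_const)

/-- `Y(t,·)` is smooth. -/
theorem contDiff_viscY (t : ℝ) : ContDiff ℝ ∞ (viscY t) := by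
  rw [show viscY t = fun x : EuclideanSpace ℝ (Fin 3) =>
      x 0 • bv 0 + x 1 • bv 1 + (x 2 - profI t (x 0)) • bv 2 from funext (viscY_eq t)]
  have hc : ∀ j : Fin 3, ContDiff ℝ ∞ (fun a : EuclideanSpace ℝ (Fin 3) => a j) := fun j =>
    (pr j).contDiff
  exact ((((hc 0).smul contDiff_const).add ((hc 1).smul contDiff_const))).add
    (((hc 2).sub ((contDiff_profI t).comp (hc 0))).smul contDiff_const)

/-- Jacobian table of `X(t,·)`. -/
def jacVX (t : ℝ) (a : EuclideanSpace ℝ (Fin 3)) : Fin 3 → Fin 3 → ℝ :=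
  ![![1, 0, profID t (a 0)], ![0, 1, 0], ![0, 0, 1]]

/-- Jacobian table of `Y(t,·)`. -/
def jacVY (t : ℝ) (x : EuclideanSpace ℝ (Fin 3)) : Fin 3 → Fin 3 → ℝ :=
  ![![1, 0, -profID t (x 0)], ![0, 1, 0], ![0, 0, 1]]

/-- Entries of the space derivative of `X(t,·)`. -/
theorem fderiv_viscX_single (t : ℝ) (a : EuclideanSpace ℝ (Fin 3)) (j i : Fin 3) :
    fderiv ℝ (viscX t) a (EuclideanSpace.single j 1) i = jacVX t a j i := by
  rw [(hasFDerivAt_viscX t a).fderiv]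
  fin_cases j <;> fin_cases i <;> simp [jacVX]

/-- Entries of the space derivative of `Y(t,·)`. -/
theorem fderiv_viscY_single (t : ℝ) (x : EuclideanSpace ℝ (Fin 3)) (j i : Fin 3) :
    fderiv ℝ (viscY t) x (EuclideanSpace.single j 1) i = jacVY t x j i := by
  rw [(hasFDerivAt_viscY t x).fderiv]
  fin_cases j <;> fin_cases i <;> simp [jacVY]

/-- `X(t,·)` is volume preserving. -/
theorem det_fderiv_viscX (t : ℝ) (a : EuclideanSpace ℝ (Fin 3)) :
    (fderiv ℝ (viscX t) a).det = 1 := by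
  rw [det_eq_clmEntry_poly]
  simp only [clmEntry, fderiv_viscX_single]
  simp [jacVX]

/-- `Y(t,·)` is volume preserving. -/
theorem det_fderiv_viscY (t : ℝ) (x : EuclideanSpace ℝ (Fin 3)) :
    (fderiv ℝ (viscY t) x).det = 1 := by
  rw [det_eq_clmEntry_poly]
  simp only [clmEntry, fderiv_viscY_single]
  simp [jacVY]

/-- The trajectory equation `∂ₜX(t,a) = u(t, X(t,a))`. -/
theorem hasDerivAt_viscX (t : ℝ) (a : EuclideanSpace ℝ (Fin 3)) :
    HasDerivAt (fun s => viscX s a) (visc t (viscX t a)) t := by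
  have e : (fun s => viscX s a) = fun s =>
      a 0 • bv 0 + a 1 • bv 1 + (a 2 + profI s (a 0)) • bv 2 :=
    funext fun s => viscX_eq s a
  rw [e]
  have h01 := hasDerivAt_const t (a 0 • bv 0 + a 1 • bv 1)
  have h2 := ((hasDerivAt_profI_t t (a 0)).const_add (a 2)).smul_const (bv 2)
  refine (h01.add h2).congr_deriv ?_
  rw [zero_add, visc, viscX_apply_zero]

/-- **The viscous shear flow carries particle-trajectory maps** in the typed sense. -/
theorem isFlowOn_visc (S : Set ℝ) :
    Literature.Claims.NS.Kyritsis2022.IsFlowOn S visc viscX viscY where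
  contDiff t _ := contDiff_viscX t
  contDiff_inv t _ := contDiff_viscY t
  hasDeriv t _ a := (hasDerivAt_viscX t a).hasDerivWithinAt
  initial := viscX_zero
  leftInv t _ a := viscY_viscX t a
  rightInv t _ x := viscX_viscY t x
  det t _ a := det_fderiv_viscX t a
  det_inv t _ x := det_fderiv_viscY t x

end Summit.NavierStokesRegularity.NavierStokesRegularity.Theorems.Kyritsis2022

end
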